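import Summits.BirchSwinnertonDyer.BirchSwinnertonDyer.Theorems.PrintCf2RubinValueTwoCMDivisionFieldAbelian
import Summits.BirchSwinnertonDyer.BirchSwinnertonDyer.Theorems.PrintCf2SplitBadTwoHPrimeBookkeeping
import Literature.NumberTheory.EllipticCurves.DivisionTowerIwasawaModule
import Literature.NumberTheory.EllipticCurves.WeilPairingProofs
import HarnessLib

/-!
# [T3]-input, part 1: signs on the layers `E[v²] ⊕ E[v̄²] = E[4]` and the Weil-pairing constraint
# `a₁a₂ ≡ χ_cyc (mod 4)` — (hb) «some τ₀ ∈ Υ fixes EXACTLY ONE layer» DISCHARGED for `K = ℚ(√−7)`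

Cell `bsd-print-cf2`, width seat `bsd-line-cf2-p1-w8` g6; class item `MainConjClauseAtSplitTwoQuadDAClass` (rev 23,
`stmt-BirchSwinnertonDyer-23300`), step (0) of cf2c-w2 g8's (Q)-class RECIPE 15:38:32Z «pick τᵢ ∈ Υ with
gᵢ := γᵢτᵢ ∈ Gal(K̄/K(E′_q))» (GO 15:37:54Z).  `--supports` 23300 (helper); Theses-free; THEOREMS ONLY; 0 facts.

Setting (the Deuring split print's, p728742): `E[2^∞] = M₁ ⊕ M₂` (`M₁ ⊔ M₂ = ⊤`, `M₁ ⊓ M₂ = ⊥`), both `Γ_K`-stable,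
CYCLIC layers `Mᵢ[4] = Mᵢ ⊓ E[2^∞][4] = ℤ·gᵢ`, `ord gᵢ = 4`.  `Fixᵢ(σ)` := «`σ` fixes `Mᵢ[4]` pointwise».

* §1 `smul_eq_self_or_eq_neg_of_cyclic_layer_four` (every `σ` acts on `Mᵢ[4]` as `±1`), `fix_mul_iff` (signs multiply),
  `forall_smul_geomTorsion_four_eq_self_iff` (`σ` fixes `E[4]` iff `Fix₁ σ ∧ Fix₂ σ`),
  `exists_zsmul_add_zsmul_of_geomTorsion_four` (`E[4] = ℤG₁ + ℤG₂` for the lifts `Gᵢ` of `gᵢ`).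
* §2 ★ `fix_iff_not_fix_of_smul_sqrt_neg_one` — **if `τ(√−1) = −√−1` then `τ` fixes EXACTLY ONE of `M₁[4]`, `M₂[4]`**:
  the tree's Weil pairing `e₄` (KERNEL theorem `WeierstrassCurve.exists_weilPairing_holds`, AEC III.8.1) gives
  `ζ := e₄(G₁, G₂)` with `ζ² = −1` (non-degeneracy + the decomposition) and `τ•ζ = e₄(τG₁, τG₂) = ζ^{a₁a₂}`, so the
  diagonal patterns `(+,+)`, `(−,−)` force `τ•ζ = ζ ≠ −ζ`.  (= «`a₁a₂ ≡ χ_cyc (mod 4)`», my 15:22:00Z input (b).)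
* §3 ★ `exists_mem_pairKer_fix_iff_not_fix` — **(hb) for `Υ = pairKer κ₁ κ₂`, `K` imaginary quadratic with
  `d_K = −7`, ANY elliptic `W/K` with such components**: p727863 `HPrime.exists_mem_pairKer_smul_sqrt_neg_one_eq_neg`
  (`K(i) ⊄ K̃_∞`) supplies `τ₀ ∈ Υ` with `τ₀(i) = −i`.

HONEST FRAMING: closes nothing by itself; no summit statement is proved by this seat; BSD is not proved by any of this.

## References
* [SilvermanAEC2009] J. H. Silverman, *The Arithmetic of Elliptic Curves* (2009), III.8.1 (Weil pairing), III.8.1.1.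
* [Rubin1999] K. Rubin, LNM 1716 (1999), §5 Prop. 5.4, Cor. 5.5, (7).
* [Washington1997] L. C. Washington, *Introduction to Cyclotomic Fields* (1997), §13.1 (`K̃_∞`).
-/

-- the summit namespace `Summit.BirchSwinnertonDyer.BirchSwinnertonDyer` repeats the problem name by design (D-0017)
set_option linter.dupNamespace false
set_option autoImplicit false

noncomputable section

open scoped Classical

open Field NumberField IsDedekindDomain WeierstrassCurve Literature.NumberTheory.EllipticCurves
  Literature.NumberTheory.GaloisRepresentations
open Summit.BirchSwinnertonDyer.BirchSwinnertonDyer.Theorems.PrintCf2.CMDivisionFieldAbelian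
  (exists_int_forall_smul_eq_of_cyclic_layer)

namespace Summit.BirchSwinnertonDyer.BirchSwinnertonDyer.Theorems.PrintCf2.UpsilonSurjects

section Abstract

variable {K : Type} [Field K] (W : WeierstrassCurve K)

/-! ## §1. Signs on the cyclic layers `Mᵢ[4] = ℤ·gᵢ` -/

/-- **On a `Γ_K`-stable component whose layer `M[4] = ℤ·g` is cyclic of order `4`, every `σ` acts as `±1`:
`σ • g = g` or `σ • g = −g`** (p728742's integer scalar is a unit mod `4`: an even scalar would kill `2g ≠ 0`).
[cite: Rubin1999, §5 Prop. 5.4] -/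
theorem smul_eq_self_or_eq_neg_of_cyclic_layer_four {M : AddSubgroup (geomPrimaryTorsion W 2)}
    (hst : ∀ σ : absoluteGaloisGroup K, ∀ x ∈ M, σ • x ∈ M) {g : geomPrimaryTorsion W 2} (hord : addOrderOf g = 2 ^ 2)
    (hg : M ⊓ AddSubgroup.torsionBy (geomPrimaryTorsion W 2) (2 ^ 2) = AddSubgroup.zmultiples g)
    (σ : absoluteGaloisGroup K) : σ • g = g ∨ σ • g = -g := by
  obtain ⟨a, ha⟩ := exists_int_forall_smul_eq_of_cyclic_layer W 2 hst hg σ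
  have hgmem : g ∈ M ⊓ AddSubgroup.torsionBy (geomPrimaryTorsion W 2) (2 ^ 2) := hg ▸ AddSubgroup.mem_zmultiples g
  have hσg : σ • g = a • g := ha g hgmem
  have h4 : (4 : ℤ) • g = 0 := by
    have := addOrderOf_nsmul_eq_zero g
    rw [hord] at this
    rw [← natCast_zsmul] at this
    exact_mod_cast this
  have h2 : (2 : ℤ) • g ≠ 0 := by
    intro h
    have hdvd := addOrderOf_dvd_of_nsmul_eq_zero (n := 2) (x := g) (by rw [← natCast_zsmul]; exact_mod_cast h)
    rw [hord] at hdvd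
    norm_num at hdvd
  -- `a` is odd: otherwise `σ • (2g) = 0`, contradicting injectivity of `σ`
  obtain ⟨b, hb | hb⟩ := Int.even_or_odd' a
  · exfalso
    apply h2
    have h0 : σ • ((2 : ℤ) • g) = 0 := by
      rw [smul_comm, hσg, hb, smul_smul, show (2 : ℤ) * (2 * b) = b * 4 by ring, mul_smul, h4, smul_zero]
    simpa using congrArg (σ⁻¹ • ·) h0
  · -- `a = 2b + 1`; `b` even gives `+1`, `b` odd gives `−1`
    obtain ⟨c, hc | hc⟩ := Int.even_or_odd' b
    · left
      rw [hσg, hb, hc, show (2 : ℤ) * (2 * c) + 1 = c * 4 + 1 by ring, add_smul, mul_smul, h4, smul_zero, zero_add,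
        one_smul]
    · right
      rw [hσg, hb, hc, show (2 : ℤ) * (2 * c + 1) + 1 = (c + 1) * 4 + (-1) by ring, add_smul, mul_smul, h4, smul_zero,
        zero_add, neg_one_smul]

/-- If `σ • g = g` then `σ` fixes the whole layer `ℤ·g`. [folklore] -/
theorem forall_smul_eq_self_of_smul_eq {g : geomPrimaryTorsion W 2} {σ : absoluteGaloisGroup K} (h : σ • g = g) :
    ∀ x ∈ AddSubgroup.zmultiples g, σ • x = x := by
  intro x hx
  obtain ⟨c, rfl⟩ := AddSubgroup.mem_zmultiples_iff.mp hx
  rw [smul_comm, h]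

/-- If `σ • g = −g` then `σ` negates the whole layer `ℤ·g`. [folklore] -/
theorem forall_smul_eq_neg_of_smul_eq {g : geomPrimaryTorsion W 2} {σ : absoluteGaloisGroup K} (h : σ • g = -g) :
    ∀ x ∈ AddSubgroup.zmultiples g, σ • x = -x := by
  intro x hx
  obtain ⟨c, rfl⟩ := AddSubgroup.mem_zmultiples_iff.mp hx
  rw [smul_comm, h, smul_neg]

/-- An element of order `4` is not its own negative. [folklore] -/
theorem ne_neg_of_addOrderOf_eq_four {g : geomPrimaryTorsion W 2} (hord : addOrderOf g = 2 ^ 2) : g ≠ -g := by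
  intro h
  have h2 : (2 : ℕ) • g = 0 := by rw [two_nsmul]; nth_rw 2 [h]; exact add_neg_cancel g
  have hdvd := addOrderOf_dvd_of_nsmul_eq_zero h2
  rw [hord] at hdvd; norm_num at hdvd

/-- **Sign multiplicativity on a layer**: `στ` fixes `M[4]` iff (`σ` fixes it ↔ `τ` fixes it). [folklore] -/
theorem fix_mul_iff {M : AddSubgroup (geomPrimaryTorsion W 2)}
    (hst : ∀ σ : absoluteGaloisGroup K, ∀ x ∈ M, σ • x ∈ M) {g : geomPrimaryTorsion W 2} (hord : addOrderOf g = 2 ^ 2)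
    (hg : M ⊓ AddSubgroup.torsionBy (geomPrimaryTorsion W 2) (2 ^ 2) = AddSubgroup.zmultiples g)
    (σ τ : absoluteGaloisGroup K) :
    (∀ x ∈ M ⊓ AddSubgroup.torsionBy (geomPrimaryTorsion W 2) (2 ^ 2), (σ * τ) • x = x) ↔
      ((∀ x ∈ M ⊓ AddSubgroup.torsionBy (geomPrimaryTorsion W 2) (2 ^ 2), σ • x = x) ↔
        (∀ x ∈ M ⊓ AddSubgroup.torsionBy (geomPrimaryTorsion W 2) (2 ^ 2), τ • x = x)) := by
  have hgmem : g ∈ M ⊓ AddSubgroup.torsionBy (geomPrimaryTorsion W 2) (2 ^ 2) := hg ▸ AddSubgroup.mem_zmultiples g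
  have hg0 : g ≠ -g := ne_neg_of_addOrderOf_eq_four W hord
  -- reduce each «fixes the layer» to «fixes g»
  have hred : ∀ ρ : absoluteGaloisGroup K,
      (∀ x ∈ M ⊓ AddSubgroup.torsionBy (geomPrimaryTorsion W 2) (2 ^ 2), ρ • x = x) ↔ ρ • g = g := fun ρ ↦
    ⟨fun h ↦ h g hgmem, fun h x hx ↦ forall_smul_eq_self_of_smul_eq W h x (hg ▸ hx)⟩
  rw [hred, hred, hred, mul_smul]
  rcases smul_eq_self_or_eq_neg_of_cyclic_layer_four W hst hord hg σ with hσ | hσ <;>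
    rcases smul_eq_self_or_eq_neg_of_cyclic_layer_four W hst hord hg τ with hτ | hτ
  · rw [hτ, hσ]; simp
  · rw [hτ, smul_neg, hσ]
    exact ⟨fun h ↦ (hg0 h.symm).elim, fun h ↦ (hg0 (h.mp rfl).symm).elim⟩
  · rw [hτ, hσ]
    exact ⟨fun h ↦ (hg0 h.symm).elim, fun h ↦ (hg0 (h.mpr rfl).symm).elim⟩
  · rw [hτ, smul_neg, hσ, neg_neg]
    exact ⟨fun _ ↦ ⟨fun h ↦ (hg0 h.symm).elim, fun h ↦ (hg0 h.symm).elim⟩, fun _ ↦ rfl⟩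

/-- **`σ` fixes `E[4]` iff it fixes both layers `M₁[4]`, `M₂[4]`** (`E[4] ⊆ E[2^∞] = M₁ + M₂`, and `4x₁ = −4x₂ ∈
M₁ ⊓ M₂ = 0` puts the components in the layers). [cite: Rubin1999, §5 (7)] -/
theorem forall_smul_geomTorsion_four_eq_self_iff (M₁ M₂ : AddSubgroup (geomPrimaryTorsion W 2))
    (hsup : M₁ ⊔ M₂ = ⊤) (hinf : M₁ ⊓ M₂ = ⊥) (σ : absoluteGaloisGroup K) :
    (∀ T : geomTorsion W ((2 ^ 2 : ℕ) : ℤ), σ • T = T) ↔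
      ((∀ x ∈ M₁ ⊓ AddSubgroup.torsionBy (geomPrimaryTorsion W 2) (2 ^ 2), σ • x = x) ∧
        (∀ x ∈ M₂ ⊓ AddSubgroup.torsionBy (geomPrimaryTorsion W 2) (2 ^ 2), σ • x = x)) := by
  -- a point of `E[2^∞]` killed by `4`, read as a point of `E[4]`, and back
  have key : ∀ x : geomPrimaryTorsion W 2, x ∈ AddSubgroup.torsionBy (geomPrimaryTorsion W 2) (2 ^ 2) →
      ((∀ T : geomTorsion W ((2 ^ 2 : ℕ) : ℤ), σ • T = T) → σ • x = x) := by
    intro x hx hT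
    have hx4 : ((2 : ℤ) ^ 2) • x = 0 := hx
    have hx' : ((2 ^ 2 : ℕ) : ℤ) • (x : geomPoints W) = 0 := by
      have := congrArg (fun y : geomPrimaryTorsion W 2 ↦ (y : geomPoints W)) hx4
      rw [AddSubgroupClass.coe_zsmul, ZeroMemClass.coe_zero] at this
      exact_mod_cast this
    have := congrArg (fun T : geomTorsion W ((2 ^ 2 : ℕ) : ℤ) ↦ (T : geomPoints W)) (hT ⟨x, hx'⟩)
    apply Subtype.ext
    simpa only [AddSubgroup.torsionBy.coe_smul, primaryComponent.coe_smul] using this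
  constructor
  · intro hT
    exact ⟨fun x hx ↦ key x (AddSubgroup.mem_inf.mp hx).2 hT, fun x hx ↦ key x (AddSubgroup.mem_inf.mp hx).2 hT⟩
  · rintro ⟨h₁, h₂⟩ T
    -- lift `T` to `E[2^∞]` and decompose
    have hT4 : ((2 ^ 2 : ℕ) : ℤ) • (T : geomPoints W) = 0 := T.2
    have hTprim : (T : geomPoints W) ∈ geomPrimaryTorsion W 2 := ⟨2, by rw [natCast_zsmul] at hT4; exact hT4⟩
    set P : geomPrimaryTorsion W 2 := ⟨T, hTprim⟩ with hP
    have hPmem : P ∈ M₁ ⊔ M₂ := hsup ▸ AddSubgroup.mem_top P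
    obtain ⟨x₁, hx₁, x₂, hx₂, hsum⟩ := AddSubgroup.mem_sup.mp hPmem
    have hP4 : ((2 : ℤ) ^ 2) • P = 0 := by
      apply Subtype.ext
      rw [AddSubgroupClass.coe_zsmul, ZeroMemClass.coe_zero, hP]
      exact_mod_cast hT4
    -- `4x₁ = -4x₂ ∈ M₁ ⊓ M₂ = ⊥`
    have h41 : ((2 : ℤ) ^ 2) • x₁ ∈ M₁ ⊓ M₂ := by
      refine AddSubgroup.mem_inf.mpr ⟨M₁.zsmul_mem hx₁ _, ?_⟩
      have : ((2 : ℤ) ^ 2) • x₁ = -(((2 : ℤ) ^ 2) • x₂) := by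
        rw [eq_neg_iff_add_eq_zero, ← smul_add, hsum, hP4]
      rw [this]
      exact M₂.neg_mem (M₂.zsmul_mem hx₂ _)
    rw [hinf, AddSubgroup.mem_bot] at h41
    have h42 : ((2 : ℤ) ^ 2) • x₂ = 0 := by
      have : ((2 : ℤ) ^ 2) • (x₁ + x₂) = 0 := by rw [hsum, hP4]
      rwa [smul_add, h41, zero_add] at this
    have hx₁' : x₁ ∈ M₁ ⊓ AddSubgroup.torsionBy (geomPrimaryTorsion W 2) (2 ^ 2) :=
      AddSubgroup.mem_inf.mpr ⟨hx₁, h41⟩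
    have hx₂' : x₂ ∈ M₂ ⊓ AddSubgroup.torsionBy (geomPrimaryTorsion W 2) (2 ^ 2) :=
      AddSubgroup.mem_inf.mpr ⟨hx₂, h42⟩
    have hσP : σ • P = P := by rw [← hsum, smul_add, h₁ x₁ hx₁', h₂ x₂ hx₂']
    apply Subtype.ext
    have := congrArg (fun y : geomPrimaryTorsion W 2 ↦ (y : geomPoints W)) hσP
    simpa only [AddSubgroup.torsionBy.coe_smul, primaryComponent.coe_smul, hP] using this

/-- **`E[4] = ℤG₁ + ℤG₂`** for the lifts `Gᵢ ∈ E[4]` of the layer generators `gᵢ` (`E[4] ⊆ M₁ + M₂`, and `4x₁ = −4x₂ ∈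
M₁ ⊓ M₂ = 0` puts the components in the layers `ℤgᵢ`). [cite: Rubin1999, §5 (7)] -/
theorem exists_zsmul_add_zsmul_of_geomTorsion_four (M₁ M₂ : AddSubgroup (geomPrimaryTorsion W 2))
    (hsup : M₁ ⊔ M₂ = ⊤) (hinf : M₁ ⊓ M₂ = ⊥) {g₁ g₂ : geomPrimaryTorsion W 2}
    (hg₁ : M₁ ⊓ AddSubgroup.torsionBy (geomPrimaryTorsion W 2) (2 ^ 2) = AddSubgroup.zmultiples g₁)
    (hg₂ : M₂ ⊓ AddSubgroup.torsionBy (geomPrimaryTorsion W 2) (2 ^ 2) = AddSubgroup.zmultiples g₂)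
    (G₁ G₂ : geomTorsion W ((2 ^ 2 : ℕ) : ℤ)) (hG₁ : (G₁ : geomPoints W) = g₁) (hG₂ : (G₂ : geomPoints W) = g₂)
    (T : geomTorsion W ((2 ^ 2 : ℕ) : ℤ)) : ∃ c₁ c₂ : ℤ, T = c₁ • G₁ + c₂ • G₂ := by
  have hT4 : ((2 ^ 2 : ℕ) : ℤ) • (T : geomPoints W) = 0 := T.2
  have hTprim : (T : geomPoints W) ∈ geomPrimaryTorsion W 2 := ⟨2, by rw [natCast_zsmul] at hT4; exact hT4⟩
  set P : geomPrimaryTorsion W 2 := ⟨T, hTprim⟩ with hP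
  have hPmem : P ∈ M₁ ⊔ M₂ := hsup ▸ AddSubgroup.mem_top P
  obtain ⟨x₁, hx₁, x₂, hx₂, hsum⟩ := AddSubgroup.mem_sup.mp hPmem
  have hP4 : ((2 : ℤ) ^ 2) • P = 0 := by
    apply Subtype.ext
    rw [AddSubgroupClass.coe_zsmul, ZeroMemClass.coe_zero, hP]
    exact_mod_cast hT4
  have h41 : ((2 : ℤ) ^ 2) • x₁ ∈ M₁ ⊓ M₂ := by
    refine AddSubgroup.mem_inf.mpr ⟨M₁.zsmul_mem hx₁ _, ?_⟩
    have : ((2 : ℤ) ^ 2) • x₁ = -(((2 : ℤ) ^ 2) • x₂) := by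
      rw [eq_neg_iff_add_eq_zero, ← smul_add, hsum, hP4]
    rw [this]
    exact M₂.neg_mem (M₂.zsmul_mem hx₂ _)
  rw [hinf, AddSubgroup.mem_bot] at h41
  have h42 : ((2 : ℤ) ^ 2) • x₂ = 0 := by
    have : ((2 : ℤ) ^ 2) • (x₁ + x₂) = 0 := by rw [hsum, hP4]
    rwa [smul_add, h41, zero_add] at this
  have hx₁' : x₁ ∈ AddSubgroup.zmultiples g₁ := by
    rw [← hg₁]; exact AddSubgroup.mem_inf.mpr ⟨hx₁, h41⟩
  have hx₂' : x₂ ∈ AddSubgroup.zmultiples g₂ := by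
    rw [← hg₂]; exact AddSubgroup.mem_inf.mpr ⟨hx₂, h42⟩
  obtain ⟨c₁, hc₁⟩ := AddSubgroup.mem_zmultiples_iff.mp hx₁'
  obtain ⟨c₂, hc₂⟩ := AddSubgroup.mem_zmultiples_iff.mp hx₂'
  have hdec : (T : geomPoints W) = (x₁ : geomPoints W) + x₂ := by
    have := congrArg (fun y : geomPrimaryTorsion W 2 ↦ (y : geomPoints W)) hsum
    simpa only [AddMemClass.coe_add, hP] using this.symm
  refine ⟨c₁, c₂, Subtype.ext ?_⟩
  rw [AddMemClass.coe_add, AddSubgroupClass.coe_zsmul, AddSubgroupClass.coe_zsmul, hG₁, hG₂, hdec, ← hc₁, ← hc₂,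
    AddSubgroupClass.coe_zsmul, AddSubgroupClass.coe_zsmul]

/-! ## §2. The Weil pairing: `τ(√−1) = −√−1` forces a MIXED sign pattern -/

/-- ★ **If `τ • r = −r` for some `r² = −1`, then `τ` fixes EXACTLY ONE of the layers `M₁[4]`, `M₂[4]`.**  Weil pairing
`e₄` on `E[4]` (tree theorem `exists_weilPairing_holds`): `ζ := e₄(G₁, G₂)` satisfies `ζ⁴ = 1`, `ζ² ≠ 1` (else every
`S = c₁G₁ + c₂G₂` pairs trivially with `2G₂ ≠ 0`, contradicting non-degeneracy), so `ζ² = −1`, `ζ = ±r`, `τ•ζ = −ζ`;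
but Galois-equivariance gives `τ•ζ = e₄(τG₁, τG₂) = e₄(±G₁, ±G₂) = ζ` on the diagonal patterns `(+,+)`, `(−,−)`.
[cite: SilvermanAEC2009, III.8.1] [cite: Rubin1999, §5 Prop. 5.4] -/
theorem fix_iff_not_fix_of_smul_sqrt_neg_one [CharZero K] [W.IsElliptic] (M₁ M₂ : AddSubgroup (geomPrimaryTorsion W 2))
    (hsup : M₁ ⊔ M₂ = ⊤) (hinf : M₁ ⊓ M₂ = ⊥)
    (hst₁ : ∀ σ : absoluteGaloisGroup K, ∀ x ∈ M₁, σ • x ∈ M₁)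
    (hst₂ : ∀ σ : absoluteGaloisGroup K, ∀ x ∈ M₂, σ • x ∈ M₂)
    {g₁ g₂ : geomPrimaryTorsion W 2} (hord₁ : addOrderOf g₁ = 2 ^ 2) (hord₂ : addOrderOf g₂ = 2 ^ 2)
    (hg₁ : M₁ ⊓ AddSubgroup.torsionBy (geomPrimaryTorsion W 2) (2 ^ 2) = AddSubgroup.zmultiples g₁)
    (hg₂ : M₂ ⊓ AddSubgroup.torsionBy (geomPrimaryTorsion W 2) (2 ^ 2) = AddSubgroup.zmultiples g₂)
    {τ : absoluteGaloisGroup K} {r : AlgebraicClosure K} (hr : r ^ 2 = -1) (hτ : τ • r = -r) :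
    (∀ x ∈ M₁ ⊓ AddSubgroup.torsionBy (geomPrimaryTorsion W 2) (2 ^ 2), τ • x = x) ↔
      ¬ (∀ x ∈ M₂ ⊓ AddSubgroup.torsionBy (geomPrimaryTorsion W 2) (2 ^ 2), τ • x = x) := by
  -- the Weil pairing on `E[4]` and its elementary consequences
  obtain ⟨e, hpow, haddl, haddr, halt, hnd, hgal⟩ := exists_weilPairing_holds W (2 ^ 2) (by norm_num) (by norm_num)
  have hne : ∀ S T, e S T ≠ 0 := fun S T h0 ↦ by
    have := hpow S T
    rw [h0, zero_pow (by norm_num)] at this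
    exact zero_ne_one this
  have hzero_left : ∀ T, e 0 T = 1 := fun T ↦ by
    have h := haddl 0 0 T; rw [add_zero] at h; exact (mul_eq_left₀ (hne 0 T)).mp h.symm
  have hzero_right : ∀ S, e S 0 = 1 := fun S ↦ by
    have h := haddr S 0 0; rw [add_zero] at h; exact (mul_eq_left₀ (hne S 0)).mp h.symm
  have hneg_left : ∀ S T, e (-S) T = (e S T)⁻¹ := fun S T ↦ by
    have h := haddl (-S) S T; rw [neg_add_cancel, hzero_left] at h; exact (inv_eq_of_mul_eq_one_left h.symm).symm
  have hneg_right : ∀ S T, e S (-T) = (e S T)⁻¹ := fun S T ↦ by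
    have h := haddr S (-T) T; rw [neg_add_cancel, hzero_right] at h; exact (inv_eq_of_mul_eq_one_left h.symm).symm
  -- the lifts `Gᵢ ∈ E[4]` of the layer generators
  have h4g : ∀ {g : geomPrimaryTorsion W 2}, addOrderOf g = 2 ^ 2 → ((2 ^ 2 : ℕ) : ℤ) • (g : geomPoints W) = 0 := by
    intro g hord
    have h0 := addOrderOf_nsmul_eq_zero g
    rw [hord] at h0
    have h := congrArg (fun y : geomPrimaryTorsion W 2 ↦ (y : geomPoints W)) h0
    simp only [AddSubgroupClass.coe_nsmul, ZeroMemClass.coe_zero] at h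
    rw [natCast_zsmul]
    exact h
  set G₁ : geomTorsion W ((2 ^ 2 : ℕ) : ℤ) := ⟨g₁, h4g hord₁⟩ with hG₁def
  set G₂ : geomTorsion W ((2 ^ 2 : ℕ) : ℤ) := ⟨g₂, h4g hord₂⟩ with hG₂def
  have hG₁ : (G₁ : geomPoints W) = g₁ := rfl
  have hG₂ : (G₂ : geomPoints W) = g₂ := rfl
  have lift_fix : ∀ {g : geomPrimaryTorsion W 2} {G : geomTorsion W ((2 ^ 2 : ℕ) : ℤ)}, (G : geomPoints W) = g →
      ∀ {σ : absoluteGaloisGroup K}, σ • g = g → σ • G = G := by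
    intro g G hG σ h
    apply Subtype.ext
    rw [AddSubgroup.torsionBy.coe_smul, hG, ← primaryComponent.coe_smul, h]
  have lift_neg : ∀ {g : geomPrimaryTorsion W 2} {G : geomTorsion W ((2 ^ 2 : ℕ) : ℤ)}, (G : geomPoints W) = g →
      ∀ {σ : absoluteGaloisGroup K}, σ • g = -g → σ • G = -G := by
    intro g G hG σ h
    apply Subtype.ext
    rw [AddSubgroup.torsionBy.coe_smul, NegMemClass.coe_neg, hG, ← primaryComponent.coe_smul, h, NegMemClass.coe_neg]
  -- `ζ := e₄(G₁, G₂)` has `ζ² ≠ 1` (non-degeneracy + decomposition), hence `ζ² = −1`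
  set ζ := e G₁ G₂ with hζ
  have hζ2 : ζ ^ 2 ≠ 1 := by
    intro h1
    let H : AddSubgroup (geomTorsion W ((2 ^ 2 : ℕ) : ℤ)) :=
      { carrier := {S | e S ((2 : ℤ) • G₂) = 1}
        add_mem' := fun {a b} ha hb ↦ by
          simp only [Set.mem_setOf_eq] at ha hb ⊢
          rw [haddl, ha, hb, one_mul]
        zero_mem' := by
          simp only [Set.mem_setOf_eq]
          exact hzero_left _
        neg_mem' := fun {a} ha ↦ by
          simp only [Set.mem_setOf_eq] at ha ⊢
          rw [hneg_left, ha, inv_one] }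
    have hG₁H : G₁ ∈ H := by
      show e G₁ ((2 : ℤ) • G₂) = 1
      rw [two_smul, haddr, ← sq, h1]
    have hG₂H : G₂ ∈ H := by
      show e G₂ ((2 : ℤ) • G₂) = 1
      rw [two_smul, haddr, halt, one_mul]
    have htriv : ∀ S, e S ((2 : ℤ) • G₂) = 1 := by
      intro S
      obtain ⟨c₁, c₂, rfl⟩ := exists_zsmul_add_zsmul_of_geomTorsion_four W M₁ M₂ hsup hinf hg₁ hg₂ G₁ G₂ hG₁ hG₂ S
      exact H.add_mem (H.zsmul_mem hG₁H c₁) (H.zsmul_mem hG₂H c₂)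
    have h2G : (2 : ℤ) • G₂ = 0 := hnd _ htriv
    have h2g : (2 : ℕ) • g₂ = 0 := by
      apply Subtype.ext
      have := congrArg (fun y : geomTorsion W ((2 ^ 2 : ℕ) : ℤ) ↦ (y : geomPoints W)) h2G
      simp only [AddSubgroupClass.coe_zsmul, ZeroMemClass.coe_zero, hG₂] at this
      rw [AddSubgroupClass.coe_nsmul, ZeroMemClass.coe_zero, ← natCast_zsmul]
      exact_mod_cast this
    have hdvd := addOrderOf_dvd_of_nsmul_eq_zero h2g
    rw [hord₂] at hdvd
    norm_num at hdvd
  have hζ4 : ζ ^ 4 = 1 := by have := hpow G₁ G₂; norm_num at this; exact this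
  have hζsq : ζ ^ 2 = -1 := by
    have h : (ζ ^ 2) ^ 2 = 1 ^ 2 := by rw [← pow_mul, one_pow]; exact hζ4
    rcases sq_eq_sq_iff_eq_or_eq_neg.mp h with h1 | h1
    · exact absurd h1 hζ2
    · exact h1
  have hτζ : τ • ζ = -ζ := by
    rcases sq_eq_sq_iff_eq_or_eq_neg.mp (hζsq.trans hr.symm) with h1 | h1
    · rw [h1, hτ]
    · rw [h1, smul_neg, hτ]
  have hζne : ζ ≠ -ζ := by
    intro h
    have h2 : (2 : AlgebraicClosure K) * ζ = 0 := by rw [two_mul]; nth_rw 1 [h]; exact neg_add_cancel ζ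
    rcases mul_eq_zero.mp h2 with h0 | h0
    · exact two_ne_zero h0
    · exact hne G₁ G₂ h0
  -- reduce «fixes the layer» to «fixes gᵢ»
  have hgmem₁ : g₁ ∈ M₁ ⊓ AddSubgroup.torsionBy (geomPrimaryTorsion W 2) (2 ^ 2) := hg₁ ▸ AddSubgroup.mem_zmultiples g₁
  have hgmem₂ : g₂ ∈ M₂ ⊓ AddSubgroup.torsionBy (geomPrimaryTorsion W 2) (2 ^ 2) := hg₂ ▸ AddSubgroup.mem_zmultiples g₂
  have hred₁ : (∀ x ∈ M₁ ⊓ AddSubgroup.torsionBy (geomPrimaryTorsion W 2) (2 ^ 2), τ • x = x) ↔ τ • g₁ = g₁ :=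
    ⟨fun h ↦ h g₁ hgmem₁, fun h x hx ↦ forall_smul_eq_self_of_smul_eq W h x (hg₁ ▸ hx)⟩
  have hred₂ : (∀ x ∈ M₂ ⊓ AddSubgroup.torsionBy (geomPrimaryTorsion W 2) (2 ^ 2), τ • x = x) ↔ τ • g₂ = g₂ :=
    ⟨fun h ↦ h g₂ hgmem₂, fun h x hx ↦ forall_smul_eq_self_of_smul_eq W h x (hg₂ ▸ hx)⟩
  rw [hred₁, hred₂]
  have hg0₁ := ne_neg_of_addOrderOf_eq_four W hord₁
  have hg0₂ := ne_neg_of_addOrderOf_eq_four W hord₂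
  -- Galois equivariance at `(G₁, G₂)` and the four sign patterns
  have hgalζ : τ • ζ = e (τ • G₁) (τ • G₂) := hgal τ G₁ G₂
  rcases smul_eq_self_or_eq_neg_of_cyclic_layer_four W hst₁ hord₁ hg₁ τ with h₁ | h₁ <;>
    rcases smul_eq_self_or_eq_neg_of_cyclic_layer_four W hst₂ hord₂ hg₂ τ with h₂ | h₂
  · exfalso
    apply hζne
    rw [← hτζ, hgalζ, lift_fix hG₁ h₁, lift_fix hG₂ h₂]
  · exact ⟨fun _ h ↦ hg0₂ (h.symm.trans h₂), fun _ ↦ h₁⟩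
  · exact ⟨fun h ↦ (hg0₁ (h.symm.trans h₁)).elim, fun h ↦ (h h₂).elim⟩
  · exfalso
    apply hζne
    rw [← hτζ, hgalζ, lift_neg hG₁ h₁, lift_neg hG₂ h₂, hneg_left, hneg_right, inv_inv]

end Abstract

/-! ## §3. (hb) discharged for `Υ = Gal(K̄/K̃_∞)`, `K = ℚ(√−7)` -/

section PairKer

variable {K : Type} [Field K] [NumberField K] (W : WeierstrassCurve K) [W.IsElliptic]

/-- ★ **(hb) for `Υ = pairKer κ₁ κ₂`**: for `K` imaginary quadratic with `d_K = −7`, any generator pair `(κ; γ)`, and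
ANY elliptic `W/K` whose `E[2^∞]` carries the two stable components with cyclic order-`4` layers, **some
`τ₀ ∈ pairKer κ₁ κ₂` fixes EXACTLY ONE of `M₁[4]`, `M₂[4]`** (`K(i) ⊄ K̃_∞`, p727863, feeds §2).
[cite: SilvermanAEC2009, III.8.1] [cite: Washington1997, §13.1] -/
theorem exists_mem_pairKer_fix_iff_not_fix (hK : IsImaginaryQuadratic K) (hdK : NumberField.discr K = -7)
    (M₁ M₂ : AddSubgroup (geomPrimaryTorsion W 2)) (hsup : M₁ ⊔ M₂ = ⊤) (hinf : M₁ ⊓ M₂ = ⊥)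
    (hst₁ : ∀ σ : absoluteGaloisGroup K, ∀ x ∈ M₁, σ • x ∈ M₁)
    (hst₂ : ∀ σ : absoluteGaloisGroup K, ∀ x ∈ M₂, σ • x ∈ M₂)
    {g₁ g₂ : geomPrimaryTorsion W 2} (hord₁ : addOrderOf g₁ = 2 ^ 2) (hord₂ : addOrderOf g₂ = 2 ^ 2)
    (hg₁ : M₁ ⊓ AddSubgroup.torsionBy (geomPrimaryTorsion W 2) (2 ^ 2) = AddSubgroup.zmultiples g₁)
    (hg₂ : M₂ ⊓ AddSubgroup.torsionBy (geomPrimaryTorsion W 2) (2 ^ 2) = AddSubgroup.zmultiples g₂)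
    {κ₁ κ₂ : ZpExtension K 2} {γ₁ γ₂ : absoluteGaloisGroup K} (hγ : ZpExtension.IsTopGeneratorPair κ₁ κ₂ γ₁ γ₂) :
    ∃ τ₀ ∈ ZpExtension.pairKer κ₁ κ₂,
      ((∀ x ∈ M₁ ⊓ AddSubgroup.torsionBy (geomPrimaryTorsion W 2) (2 ^ 2), τ₀ • x = x) ↔
        ¬ (∀ x ∈ M₂ ⊓ AddSubgroup.torsionBy (geomPrimaryTorsion W 2) (2 ^ 2), τ₀ • x = x)) := by
  obtain ⟨i, hi⟩ := IsAlgClosed.exists_pow_nat_eq (-1 : AlgebraicClosure K) (by norm_num : 0 < 2)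
  obtain ⟨τ₀, hτ₀, hτi⟩ := HPrime.exists_mem_pairKer_smul_sqrt_neg_one_eq_neg hK hdK hγ hi
  exact ⟨τ₀, hτ₀, fix_iff_not_fix_of_smul_sqrt_neg_one W M₁ M₂ hsup hinf hst₁ hst₂ hord₁ hord₂ hg₁ hg₂ hi hτi⟩

end PairKer

end Summit.BirchSwinnertonDyer.BirchSwinnertonDyer.Theorems.PrintCf2.UpsilonSurjects
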